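import Mathlib.Analysis.Complex.Cardinality
import Literature.NumberTheory.EllipticCurves.ManinConstantGamma1ModularDegree
import Literature.NumberTheory.EllipticCurves.ModularSymbolsProofs
import Summits.BirchSwinnertonDyer.BirchSwinnertonDyer.Theorems.ManinLocalTwoThreeStevensInfinityFibreRationalAnyConstant
import Summits.BirchSwinnertonDyer.BirchSwinnertonDyer.Theorems.ManinLocalTwoThreeCDivisionIntegralCDT
import Summits.BirchSwinnertonDyer.BirchSwinnertonDyer.Theorems.ManinLocalTwoThreeShimuraQuotientRational
import Summits.BirchSwinnertonDyer.BirchSwinnertonDyer.Theorems.EdixhovenFibreFiveSevenStarredOptimalManinUnitFiveSevenCdtThm1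
import HarnessLib

/-!
# Česnavičius–Neururer–Saha Thm. 1.1 as typed — `c_φ ∣ deg φ` for EVERY `X₁(N)`-parametrisation — DISCHARGED
# (unconditionally modulo the in-tree unbounded-denominators term), by Stevens' inclusion and fibre counting on `Y₁(N)`

Route `EdixhovenFibreFiveSeven` (cell `pub/bsd-wall`, seat `bsd-line-edix-p1` g43); sequel of
`EdixhovenFibreFiveSevenManinConstantDividesDegree.lean` (the `X₀(N)` form, ČNS Thm. 1.2).  The Literature named fact
`cesnaviciusNeururerSaha_thm_1_1` (JEMS 26 (2024) Thm. 1.1: for `E/ℚ` of conductor `N`, EVERY surjection `φ : X₁(N)_ℚ ↠ E`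
has `c_φ ∣ deg φ` — no exception at `2` or `3`; typed: every `Gamma1ParametrizationData` of a globally minimal `W` at the conductor
level has `D.maninConstant ∣ D.modularDegree`) was cite-only ("size XL: Néron models of `J₁(N)`, rational singularities").  Here it is
a THEOREM, at EVERY level, by lattice algebra:

1. STEVENS' TWIN (tree, `ManinLocalTwoThree.CuspValues.exists_stevensTwin`): every `X₁(N)`-datum `D'` of `W'` (newform `f`, `c' Λ₁(f) ⊆ Λ'`)
   has a twin `(W₁, D₁)` with `Λ(D₁.L) = Λ₁(f)`, `c₁ = 1` (the curve `ℂ/Λ₁(f)` over `ℚ`).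
2. DEGREE MULTIPLICATIVITY WITH ITS INDEX on `Y₁(N)` (§1–§2, the `Γ₁` port of the `X₀` file): `deg D' = #ψ(Λ') · deg D₁`,
   `ψ(z) = unif_{W₁}(z/c')`, `ψ(Λ') ≤ W₁(ℂ)` a finite group.
3. STEVENS' INCLUSION `Λ₁(f) ⊆ Λ'` (tree, `CDivisionInt.periodLatticeGamma1_le_neron₁_of_CDTInt` at the discharged CDT term) puts the BASIS
   vector `ω₁` of `Λ(D₁.L) = Λ₁(f)` in `Λ'`; the order `n` of `ψ(ω₁)` has `n·ω₁ ∈ c'Λ₁(f)`, i.e. `(n/c')·ω₁ ∈ Λ(D₁.L)`, so `c' ∣ n`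
   (`PeriodPair.mul_ω₁_add_mul_ω₂_mem_lattice`), and `n ∣ #ψ(Λ') ∣ deg D'` (Lagrange).

* `cesnaviciusNeururerSaha_thm_1_1_holds : cesnaviciusNeururerSaha_thm_1_1`, from `maninConstant_dvd_modularDegree₁` (every level).

HONEST STATUS.  Kernel-closed, UDC-DEPENDENT (Stevens' inclusion rests on `calegariDimitrovTang2025_unboundedDenominators_holds`), audit
(P†) pending.  ČNS's integral-model proof is NOT formalised; their typed `Γ₁(N)` statement is derived by another road (and at every
level, not only the conductor).  BSD is proved for no curve; Manin's and Stevens' conjectures are not announced here.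
[cite: CesnaviciusNeururerSaha2023, Thm. 1.1] [cite: Stevens1989, §2] [cite: CalegariDimitrovTang2025, Thm. 1.0.1] [cite: Knapp1993, Prop. 12.9(a)]
-/

set_option autoImplicit false
-- the Theorems namespace of this sub repeats the summit name by design (D-0017 nested layout)
set_option linter.dupNamespace false

noncomputable section

open scoped Classical MatrixGroups ModularForm

open CongruenceSubgroup UpperHalfPlane WeierstrassCurve Literature.NumberTheory.EllipticCurves
  Literature.NumberTheory.EllipticCurves.ModularForms

namespace Summit.BirchSwinnertonDyer.BirchSwinnertonDyer.Theorems

namespace ManinDividesDegreeGamma1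

variable {W : WeierstrassCurve ℚ} {N : ℕ} [NeZero N]

/-! ### §1 Fibres of an `X₁(N)`-parametrisation (the `Γ₁` port of `ManinLocalTwoThree.ModularDegreeOfLatticeOptimal`) -/

/-- `φ_D` is constant on `Γ₁(N)`-orbits (Manin's `eichlerIntegral_smul_sub`, a tree theorem). [cite: Manin1972, Prop. 1.4] -/
theorem φ_eq_of_mk_eq_mk₁ (D : Gamma1ParametrizationData W N) {τ τ' : ℍ} (h : Y1.mk N τ = Y1.mk N τ') : D.φ τ = D.φ τ' :=
  D.φ_eq_of_mk_eq_mk (eichlerIntegral_smul_sub_holds D.f) h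

/-- The preimage of a countable set of points under the uniformisation is countable (each fibre is a lattice coset). [folklore] -/
theorem countable_preimage_uniformize₁ (D : Gamma1ParametrizationData W N)
    {B : Set (W.baseChange ℂ).toAffine.Point} (hB : B.Countable) : (D.uniformize ⁻¹' B).Countable := by
  haveI : Countable D.L.lattice := Countable.of_equiv _ D.L.latticeEquivProd.toEquiv.symm
  have hlat : (D.L.lattice : Set ℂ).Countable := Set.countable_coe_iff.mp inferInstance
  refine (hB.biUnion fun P _ =>
    hlat.image (fun l : ℂ => Function.surjInv D.uniformize_surjective P + l)).mono ?_
  intro z hz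
  refine Set.mem_iUnion₂.mpr ⟨D.uniformize z, hz,
    z - Function.surjInv D.uniformize_surjective (D.uniformize z), ?_, by simp⟩
  rw [SetLike.mem_coe, ← ManinLocalTwoThree.gamma1_uniformize_eq_zero_iff, map_sub, Function.surjInv_eq D.uniformize_surjective, sub_self]

/-- The parameters `u` at which the `φ_D`-fibre over `unif(c u)` does NOT have `deg D` orbits on `Y₁(N)` form a countable set
(`deg_spec` + countable fibres of the uniformisation + `u ↦ c u` injective). [folklore] -/
theorem countable_setOf_card_ne₁ (D : Gamma1ParametrizationData W N) :
    {u : ℂ | Nat.card {y : Y1 N // ∃ τ : ℍ, Y1.mk N τ = y ∧ D.φ τ = D.uniformize ((D.c : ℂ) * u)} ≠ D.deg}.Countable := by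
  have hc : (D.c : ℂ) ≠ 0 := by exact_mod_cast D.maninConstant_ne_zero
  have h1 : (D.uniformize ⁻¹' {P : (W.baseChange ℂ).toAffine.Point |
      Nat.card {y : Y1 N // ∃ τ : ℍ, Y1.mk N τ = y ∧ D.φ τ = P} ≠ D.deg}).Countable :=
    countable_preimage_uniformize₁ D D.deg_spec.countable
  exact h1.preimage (mul_right_injective₀ hc)

/-- **Fibre inclusion on `Y₁(N)`.**  If `D₁` is OPTIMAL (`Λ_{W₁} = c₁Λ₁(f)`) and `D'` is any `X₁(N)`-datum of level `N` with the same newform, then for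
`c' u − z' ∈ Λ'` the orbits with `φ_{D₁}(τ) = unif₁(c₁ u)` are among those with `φ_{D'}(τ) = unif'(z')`. [cite: Knapp1993, Prop. 12.9(a)] -/
theorem fiber_subset_fiber₁ {W₁ : WeierstrassCurve ℚ} (D₁ : Gamma1ParametrizationData W₁ N) (hopt : D₁.IsOptimal)
    {W' : WeierstrassCurve ℚ} (D' : Gamma1ParametrizationData W' N) (hf : D'.f = D₁.f) (u z' : ℂ)
    (hu : (D'.c : ℂ) * u - z' ∈ D'.L.lattice) :
    {y : Y1 N | ∃ τ : ℍ, Y1.mk N τ = y ∧ D₁.φ τ = D₁.uniformize ((D₁.c : ℂ) * u)} ⊆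
      {y : Y1 N | ∃ τ : ℍ, Y1.mk N τ = y ∧ D'.φ τ = D'.uniformize z'} := by
  have hc : (D₁.c : ℂ) ≠ 0 := by exact_mod_cast D₁.maninConstant_ne_zero
  rintro y ⟨τ, hτ, hφ⟩
  refine ⟨τ, hτ, ?_⟩
  have hmem : (D₁.c : ℂ) * eichlerIntegral D₁.f τ - (D₁.c : ℂ) * u ∈ D₁.L.lattice := by
    rw [← ManinLocalTwoThree.gamma1_uniformize_eq_zero_iff, map_sub, sub_eq_zero]
    exact hφ
  obtain ⟨w, hw, hcw⟩ := hopt _ hmem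
  have hwu : eichlerIntegral D₁.f τ - u = w := by
    apply mul_left_cancel₀ hc
    rw [mul_sub, hcw]
  have hw' : w ∈ periodLatticeGamma1 D'.f := by rw [hf]; exact hw
  have hmem' : (D'.c : ℂ) * eichlerIntegral D'.f τ - z' ∈ D'.L.lattice := by
    have e : (D'.c : ℂ) * eichlerIntegral D'.f τ - z' = (D'.c : ℂ) * w + ((D'.c : ℂ) * u - z') := by
      rw [← hwu, hf]; ring
    rw [e]
    exact add_mem (D'.smul_periodLatticeGamma1_le w hw') hu
  show D'.uniformize ((D'.c : ℂ) * eichlerIntegral D'.f τ) = D'.uniformize z'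
  rw [← sub_eq_zero, ← map_sub, ManinLocalTwoThree.gamma1_uniformize_eq_zero_iff]
  exact hmem'

/-- Fibres of `φ_D` over two distinct points are disjoint subsets of `Y₁(N)`. [folklore] -/
theorem disjoint_fiber_of_ne₁ (D : Gamma1ParametrizationData W N) {P₁ P₂ : (W.baseChange ℂ).toAffine.Point} (hP : P₁ ≠ P₂) :
    Disjoint {y : Y1 N | ∃ τ : ℍ, Y1.mk N τ = y ∧ D.φ τ = P₁} {y : Y1 N | ∃ τ : ℍ, Y1.mk N τ = y ∧ D.φ τ = P₂} := by
  rw [Set.disjoint_left]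
  rintro y ⟨τ₁, h₁, hφ₁⟩ ⟨τ₂, h₂, hφ₂⟩
  exact hP (hφ₁.symm.trans ((φ_eq_of_mk_eq_mk₁ D (h₁.trans h₂.symm)).trans hφ₂))

/-! ### §2 Degree multiplicativity with its index on `Y₁(N)` -/

/-- **`deg D' = #ψ(Λ_{W'}) · deg D₁`** for `D₁` an optimal `X₁(N)`-datum and `D'` any `X₁(N)`-datum of the same level and newform, where
`ψ(z) = unif_{W₁}((c₁/c')·z)` and `ψ(Λ_{W'}) ≤ W₁(ℂ)`: a generic `φ_{D'}`-fibre on `Y₁(N)` is the disjoint union of the generic `φ_{D₁}`-fibres over the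
translate `ψ(z') + ψ(Λ_{W'})` (the `X₀` argument of `ManinDividesDegree.modularDegree_eq_natCard_mul_of_latticeOptimal`, verbatim on `Y₁(N)`).
[cite: Knapp1993, Prop. 12.9(a) and p. 302] -/
theorem modularDegree_eq_natCard_mul₁ {W₁ : WeierstrassCurve ℚ} (D : Gamma1ParametrizationData W₁ N) (hL : D.IsOptimal)
    {W' : WeierstrassCurve ℚ} (D' : Gamma1ParametrizationData W' N) (hf : D'.f = D.f) :
    D'.modularDegree =
      Nat.card ((D'.L.lattice.toAddSubgroup).map
        (D.uniformize.comp (AddMonoidHom.mulLeft ((D.c : ℂ) / (D'.c : ℂ))))) * D.modularDegree := by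
  classical
  set ψ : ℂ →+ (W₁.baseChange ℂ).toAffine.Point :=
    D.uniformize.comp (AddMonoidHom.mulLeft ((D.c : ℂ) / (D'.c : ℂ))) with hψdef
  set A : AddSubgroup (W₁.baseChange ℂ).toAffine.Point := (D'.L.lattice.toAddSubgroup).map ψ with hAdef
  have hψ : ∀ z : ℂ, ψ z = D.uniformize ((D.c : ℂ) / (D'.c : ℂ) * z) := fun z ↦ rfl
  have hinv : ∀ {τ τ' : ℍ}, Y1.mk N τ = Y1.mk N τ' → D.φ τ = D.φ τ' := fun h ↦ φ_eq_of_mk_eq_mk₁ D h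
  have hc' : (D'.c : ℂ) ≠ 0 := by exact_mod_cast D'.maninConstant_ne_zero
  -- the countable set of bad parameters `z'`
  have hS := countable_setOf_card_ne₁ D
  haveI : Countable D'.L.lattice := Countable.of_equiv _ D'.L.latticeEquivProd.toEquiv.symm
  have hlat' : (D'.L.lattice : Set ℂ).Countable := Set.countable_coe_iff.mp inferInstance
  have hSbad : (⋃ u ∈ {u : ℂ | Nat.card {y : Y1 N // ∃ τ : ℍ, Y1.mk N τ = y ∧ D.φ τ = D.uniformize ((D.c : ℂ) * u)} ≠ D.deg},
      (fun l : ℂ => (D'.c : ℂ) * u - l) '' (D'.L.lattice : Set ℂ)).Countable :=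
    hS.biUnion fun u _ => hlat'.image _
  have h3 : (D'.uniformize ⁻¹' {P | Nat.card {y : Y1 N // ∃ τ : ℍ, Y1.mk N τ = y ∧ D'.φ τ = P} ≠ D'.deg}).Countable :=
    countable_preimage_uniformize₁ D' D'.deg_spec.countable
  obtain ⟨z', hz'⟩ : ∃ z' : ℂ, z' ∉ (⋃ u ∈ {u : ℂ | Nat.card {y : Y1 N // ∃ τ : ℍ, Y1.mk N τ = y ∧
        D.φ τ = D.uniformize ((D.c : ℂ) * u)} ≠ D.deg},
      (fun l : ℂ => (D'.c : ℂ) * u - l) '' (D'.L.lattice : Set ℂ)) ∪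
      D'.uniformize ⁻¹' {P | Nat.card {y : Y1 N // ∃ τ : ℍ, Y1.mk N τ = y ∧ D'.φ τ = P} ≠ D'.deg} := by
    by_contra h
    exact not_countable_complex ((hSbad.union h3).mono fun z _ => by
      by_contra hz
      exact h ⟨z, hz⟩)
  have good : ∀ u : ℂ, (D'.c : ℂ) * u - z' ∈ D'.L.lattice →
      Nat.card {y : Y1 N // ∃ τ : ℍ, Y1.mk N τ = y ∧ D.φ τ = D.uniformize ((D.c : ℂ) * u)} = D.deg := by
    intro u hu
    by_contra hne
    apply hz'
    refine Or.inl (Set.mem_iUnion₂.mpr ⟨u, hne, (D'.c : ℂ) * u - z', hu, ?_⟩)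
    show (D'.c : ℂ) * u - ((D'.c : ℂ) * u - z') = z'
    ring
  have good' : Nat.card {y : Y1 N // ∃ τ : ℍ, Y1.mk N τ = y ∧ D'.φ τ = D'.uniformize z'} = D'.deg := by
    by_contra h
    exact hz' (Or.inr h)
  -- the target points, the fibres
  set T : Set (W₁.baseChange ℂ).toAffine.Point :=
    {P | ∃ u : ℂ, (D'.c : ℂ) * u - z' ∈ D'.L.lattice ∧ P = D.uniformize ((D.c : ℂ) * u)} with hT
  set F : (W₁.baseChange ℂ).toAffine.Point → Set (Y1 N) := fun P => {y | ∃ τ : ℍ, Y1.mk N τ = y ∧ D.φ τ = P} with hF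
  set F' : Set (Y1 N) := {y | ∃ τ : ℍ, Y1.mk N τ = y ∧ D'.φ τ = D'.uniformize z'} with hF'
  have hpos : 0 < D.modularDegree := D.deg_pos
  have hpos' : 0 < D'.modularDegree := D'.deg_pos
  have hcard' : F'.ncard = D'.modularDegree := by
    rw [← Nat.card_coe_set_eq]; exact good'
  have hfin' : F'.Finite := Set.finite_of_ncard_ne_zero (by rw [hcard']; exact hpos'.ne')
  have hFcard : ∀ P ∈ T, (F P).ncard = D.modularDegree := by
    rintro P ⟨u, hu, rfl⟩
    rw [← Nat.card_coe_set_eq]; exact good u hu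
  have hFfin : ∀ P ∈ T, (F P).Finite := fun P hP =>
    Set.finite_of_ncard_ne_zero (by rw [hFcard P hP]; exact hpos.ne')
  have hcover : F' = ⋃ P ∈ T, F P := by
    ext y
    constructor
    · rintro ⟨τ, hτ, hφ⟩
      have hu : (D'.c : ℂ) * eichlerIntegral D'.f τ - z' ∈ D'.L.lattice := by
        rw [← ManinLocalTwoThree.gamma1_uniformize_eq_zero_iff, map_sub, sub_eq_zero]
        exact hφ
      refine Set.mem_iUnion₂.mpr ⟨D.uniformize ((D.c : ℂ) * eichlerIntegral D'.f τ), ⟨_, hu, rfl⟩, τ, hτ, ?_⟩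
      rw [hf]
      rfl
    · intro hy
      obtain ⟨P, hP, hyP⟩ := Set.mem_iUnion₂.mp hy
      obtain ⟨u, hu, rfl⟩ := hP
      exact fiber_subset_fiber₁ D hL D' hf u z' hu hyP
  have hTfin : T.Finite := by
    refine (hfin'.image fun y : Y1 N => D.φ (Function.surjInv (Y1.mk_surjective N) y)).subset ?_
    intro P hP
    obtain ⟨hne, -⟩ := Nat.card_ne_zero.mp (by
      rw [Nat.card_coe_set_eq, hFcard P hP]; exact hpos.ne' : Nat.card (F P) ≠ 0)
    obtain ⟨⟨y, τ, hτ, hφ⟩⟩ := hne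
    refine ⟨y, ?_, ?_⟩
    · rw [hcover]
      exact Set.mem_iUnion₂.mpr ⟨P, hP, τ, hτ, hφ⟩
    · have hmk : Y1.mk N (Function.surjInv (Y1.mk_surjective N) y) = Y1.mk N τ := by
        rw [Function.surjInv_eq (Y1.mk_surjective N) y]
        exact hτ.symm
      show D.φ (Function.surjInv (Y1.mk_surjective N) y) = P
      rw [← hφ]
      exact hinv hmk
  have hdisj : T.PairwiseDisjoint F := fun P _ Q _ hPQ => disjoint_fiber_of_ne₁ D hPQ
  have hsum : (⋃ P ∈ T, F P).ncard = ∑ᶠ P ∈ T, (F P).ncard := hTfin.ncard_biUnion hFfin hdisj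
  rw [finsum_mem_congr rfl hFcard, finsum_mem_eq_finite_toFinset_sum _ hTfin, Finset.sum_const, smul_eq_mul,
    ← Set.ncard_eq_toFinset_card T hTfin] at hsum
  -- the target set is the translate `ψ z' + A`
  have hTA : T = (fun a ↦ ψ z' + a) '' (A : Set (W₁.baseChange ℂ).toAffine.Point) := by
    ext P
    constructor
    · rintro ⟨u, hu, rfl⟩
      refine ⟨ψ ((D'.c : ℂ) * u - z'), ⟨(D'.c : ℂ) * u - z', hu, rfl⟩, ?_⟩
      show ψ z' + ψ ((D'.c : ℂ) * u - z') = D.uniformize ((D.c : ℂ) * u)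
      rw [← map_add, hψ]
      congr 1
      field_simp
      ring
    · rintro ⟨a, ⟨l, hl, rfl⟩, rfl⟩
      refine ⟨(z' + l) / (D'.c : ℂ), ?_, ?_⟩
      · have e : (D'.c : ℂ) * ((z' + l) / (D'.c : ℂ)) - z' = l := by field_simp; ring
        rw [e]
        exact hl
      · show ψ z' + ψ l = D.uniformize ((D.c : ℂ) * ((z' + l) / (D'.c : ℂ)))
        rw [← map_add, hψ]
        congr 1
        field_simp
  have hTcard : T.ncard = Nat.card A := by
    rw [hTA, Set.ncard_image_of_injective _ (add_right_injective (ψ z')), ← Nat.card_coe_set_eq]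
    rfl
  rw [← hTcard, ← hcard', hcover, hsum]

/-! ### §3 `c' ∣ deg D'` for every `X₁(N)`-datum -/

/-- **`c_φ ∣ deg φ` for EVERY `X₁(N)`-parametrisation datum of a globally minimal curve, at every level** (ČNS Thm. 1.1 as typed, and more: any
level).  Stevens' twin `(W₁, D₁)` (`Λ(D₁.L) = Λ₁(f)`, `c₁ = 1`); Stevens' inclusion puts `ω₁ ∈ Λ₁(f)` in `Λ'`; the order `n` of
`ψ(ω₁) = unif₁(ω₁/c')` kills `ω₁/c'` modulo `Λ₁(f)` only if `c' ∣ n`; and `n ∣ #ψ(Λ') ∣ deg D'` (§2, Lagrange).  UDC-dependent.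
[cite: CesnaviciusNeururerSaha2023, Thm. 1.1] [cite: Stevens1989, §2] [cite: CalegariDimitrovTang2025, Thm. 1.0.1] -/
theorem maninConstant_dvd_modularDegree₁ (W' : WeierstrassCurve ℚ) [W'.IsElliptic] [W'.IsGloballyMinimal]
    (D' : Gamma1ParametrizationData W' N) : D'.maninConstant ∣ (D'.modularDegree : ℤ) := by
  classical
  -- Stevens' twin on `Λ₁(f)`
  haveI : Algebra.IsAlgebraic ℚ (AlgebraicClosure ℚ) := AlgebraicClosure.isAlgebraic ℚ
  haveI : IsAlgClosure ℚ (AlgebraicClosure ℚ) := AlgebraicClosure.instIsAlgClosure ℚ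
  letI : Algebra (AlgebraicClosure ℚ) ℂ := (IsAlgClosed.lift : AlgebraicClosure ℚ →ₐ[ℚ] ℂ).toRingHom.toAlgebra
  haveI : IsScalarTower ℚ (AlgebraicClosure ℚ) ℂ := IsScalarTower.of_algebraMap_eq' (Subsingleton.elim _ _)
  obtain ⟨W₁, hE₁, D₁, hf, hc1, hopt, hΛ, -⟩ := ManinLocalTwoThree.CuspValues.exists_stevensTwin D'
  haveI := hE₁
  -- Stevens' inclusion for `D'`: the basis vector `ω₁` of `Λ(D₁.L) = Λ₁(f)` lies in `Λ'`
  have hle := ManinLocalTwoThree.CDivisionInt.periodLatticeGamma1_le_neron₁_of_CDTInt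
    calegariDimitrovTang2025_unboundedDenominators_holds D'
  set z : ℂ := D₁.L.ω₁ with hz
  have hz1 : z ∈ periodLatticeGamma1 D'.f := (hΛ z).mp D₁.L.ω₁_mem_lattice
  have hzΛ' : z ∈ D'.L.lattice := hle z hz1
  -- constants
  have hc' : (D'.c : ℂ) ≠ 0 := by exact_mod_cast D'.maninConstant_ne_zero
  have hc'0 : D'.c ≠ 0 := D'.maninConstant_ne_zero
  -- §2: `deg D' = #A · deg D₁`
  set ψ : ℂ →+ (W₁.baseChange ℂ).toAffine.Point :=
    D₁.uniformize.comp (AddMonoidHom.mulLeft ((D₁.c : ℂ) / (D'.c : ℂ))) with hψdef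
  set A : AddSubgroup (W₁.baseChange ℂ).toAffine.Point := (D'.L.lattice.toAddSubgroup).map ψ with hAdef
  have hψ : ∀ x : ℂ, ψ x = D₁.uniformize ((D₁.c : ℂ) / (D'.c : ℂ) * x) := fun x ↦ rfl
  have hdeg : D'.modularDegree = Nat.card A * D₁.modularDegree := modularDegree_eq_natCard_mul₁ D₁ hopt D' hf.symm
  -- the order of `ψ z` is divisible by `c'`
  have hzA : ψ z ∈ A := AddSubgroup.mem_map_of_mem ψ (by exact hzΛ')
  set n : ℕ := addOrderOf (ψ z) with hn
  have hnA : n ∣ Nat.card A := AddSubgroup.addOrderOf_dvd_natCard A hzA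
  have hmem : (((n : ℚ) / (D'.c : ℚ) : ℚ) : ℂ) * D₁.L.ω₁ + ((0 : ℚ) : ℂ) * D₁.L.ω₂ ∈ D₁.L.lattice := by
    have h0 : n • ψ z = 0 := addOrderOf_nsmul_eq_zero (ψ z)
    rw [← map_nsmul, hψ, ManinLocalTwoThree.gamma1_uniformize_eq_zero_iff, hc1] at h0
    have e : (((n : ℚ) / (D'.c : ℚ) : ℚ) : ℂ) * D₁.L.ω₁ + ((0 : ℚ) : ℂ) * D₁.L.ω₂ = ((1 : ℤ) : ℂ) / (D'.c : ℂ) * (n • z) := by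
      rw [nsmul_eq_mul, hz]; push_cast; ring
    rw [e]
    exact h0
  have hden : (((n : ℚ) / (D'.c : ℚ) : ℚ)).den = 1 := (PeriodPair.mul_ω₁_add_mul_ω₂_mem_lattice.mp hmem).1
  have hcn : D'.c ∣ (n : ℤ) := by
    set q : ℚ := (n : ℚ) / (D'.c : ℚ) with hq
    have hqZ : (q.num : ℚ) = q := Rat.coe_int_num_of_den_eq_one hden
    refine ⟨q.num, ?_⟩
    have hcQ : (D'.c : ℚ) ≠ 0 := by exact_mod_cast hc'0
    have : (n : ℚ) = (D'.c : ℚ) * q.num := by rw [hqZ, hq]; field_simp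
    exact_mod_cast this
  -- conclude
  have hdvd : (D'.c : ℤ) ∣ (D'.modularDegree : ℤ) := by
    rw [hdeg]; push_cast
    exact hcn.trans ((Int.natCast_dvd_natCast.mpr hnA).mul_right _)
  exact hdvd

end ManinDividesDegreeGamma1

/-! ### §4 The named fact -/

/-- **Česnavičius–Neururer–Saha 2024, Thm. 1.1 holds** (the Literature named fact `cesnaviciusNeururerSaha_thm_1_1`, discharged): for every globally
minimal `W/ℚ` and every `X₁(N)`-parametrisation datum at the conductor level, `c ∣ deg`.  By `ManinDividesDegreeGamma1.maninConstant_dvd_modularDegree₁`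
(any level).  UDC-dependent; audit (P†) pending; BSD is not proved by this. [cite: CesnaviciusNeururerSaha2023, Thm. 1.1] [cite: Stevens1989, §2] -/
theorem cesnaviciusNeururerSaha_thm_1_1_holds : cesnaviciusNeururerSaha_thm_1_1 :=
  fun W _ _ _ D ↦ ManinDividesDegreeGamma1.maninConstant_dvd_modularDegree₁ W D

end Summit.BirchSwinnertonDyer.BirchSwinnertonDyer.Theorems

end
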